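import Literature.Probability.RandomPlanarGeometry.SLEBubblesThm65Kappa
import Literature.Probability.RandomPlanarGeometry.SLEBubblesVersionHolds
import HarnessLib

/-!
# [LSW] Theorem 7.3, the avoidance formula (7.3): discharge of `SLEBubbles.measure_disjoint`

Proof-only file (no definition, no named fact), after

* G. F. Lawler, O. Schramm, W. Werner, *Conformal restriction: the chordal case*, J. Amer. Math.
  Soc. **16** (2003) 917–955, arXiv:math/0209343 (**[LSW]**), §7.2 (arXiv pp. 28–29), eq. (7.3):
  "By taking expectation and applying Theorem 6.5, we get `P[Ξ ∩ A = ∅] = Φ_A'(0)^α`, which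
  almost proves Theorem 7.3. For any `κ ∈ [0, 8/3]`, the law of `Ξ(κ)` is `P_{α_κ}`."

The named fact `Literature.Probability.RandomPlanarGeometry.SLEBubbles.measure_disjoint` (file
`SLEBubbles`: for `0 < κ ≤ 8/3`, a Brownian bubble measure `μ`, an independent Poisson cloud with
mean `λ_κ μ ⊗ dt`, and `A ∈ 𝒬*` with restriction data `(Φ_A, d)`,
`(preWienerMeasure ⊗ P') {Ξ(κ) ∩ A = ∅} = d^{α_κ}`) is the composition of two theorems already in
the tree:

* `SLEBubbles.lintegral_poissonAvoidance_eq_rpow_holds` (file `SLEBubblesThm65Kappa`) — [LSW]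
  Theorem 6.5 read through (7.2), for every `A ∈ 𝒬*` and `0 < κ ≤ 8/3`;
* `SLEBubbles.measure_disjoint_of_thm65` (file `SLEBubblesVersionHolds`) — the printed proof of
  (7.3) with its measure theory (null-measurability of `{Ξ ∩ A = ∅}`, measurability of the
  bubble hit sets `s_ω`, Poisson avoidance, Tonelli/Fubini) carried out.

Found during the cone audit of the fact (refuter seat, 2026-08-15): the statement was checked
faithful to [LSW] §7.2 symbol by symbol, and is hereby certified true as stated.

Mathlib: none beyond the imports.
-/

noncomputable section

namespace Literature.Probability.RandomPlanarGeometry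

/-- **DISCHARGE of `SLEBubbles.measure_disjoint`** — [LSW] Theorem 7.3's avoidance formula (7.3),
`P[Ξ(κ) ∩ A = ∅] = Φ_A'(0)^{α_κ}` for `0 < κ ≤ 8/3` and `A ∈ 𝒬*`: Theorem 6.5
(`SLEBubbles.lintegral_poissonAvoidance_eq_rpow_holds`) fed into the assembly of the printed
proof of (7.3) (`SLEBubbles.measure_disjoint_of_thm65`).
[cite: LawlerSchrammWerner2003Restriction, Thm. 7.3 with eq. (7.3) (pp. 28–29)] -/
theorem SLEBubbles.measure_disjoint_holds : SLEBubbles.measure_disjoint :=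
  SLEBubbles.measure_disjoint_of_thm65 SLEBubbles.lintegral_poissonAvoidance_eq_rpow_holds

end Literature.Probability.RandomPlanarGeometry

end
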